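import Mathlib
import Literature.Combinatorics.Additive.TripleProductProperty
import Literature.Computability.AlgebraicComplexity.GroupTheoreticMatMul
import Literature.Computability.AlgebraicComplexity.GroupTheoreticMatMulThmBProofs
import Summits.MatrixMultiplication.MatrixMultiplication.Theorems.AutomaticSTPPDesignsAutomaticPackingThesisStubConcatSTPP

/-!
# Three-fold concatenation with product block sizes — stub `stub_tripleConcat` of line `Sketch`
(crux `AutomaticPackingThesis`, stmt-MatrixMultiplication-7356)

Three finite STPP designs living in `ℤ/p^K₁`, `ℤ/p^K₂`, `ℤ/p^K₃` of one cyclic `p`-tower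
(indexed by `Fin n₁`, `Fin n₂`, `Fin n₃`) concatenate into one STPP family in
`ℤ/p^(K₁+K₂+K₃)` indexed by `Fin n₁ × Fin n₂ × Fin n₃`, with block sizes the products of the
corresponding block sizes (CKSU 2005, Lemma 5.4 inside a `p`-tower, applied twice). This is the
bookkeeping behind the UNIFORM normal form of the crux: a design with one size profile
`(a, b, c)` concatenated with its two role rotations has all blocks of size `abc`.

Proof: the two-fold lemma `stub_concatSTPP` twice (first `K₁` with `K₂`, then `K₁ + K₂` with
`K₃`; the exponent `K₁ + K₂ + K₃` parses as `(K₁ + K₂) + K₃`), reindexed along the injection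
`(i, j, k) ↦ ((i, j), k)` by `AddSimultaneousTPP.comp`; sizes multiply by `card_concat`.
-/

set_option linter.dupNamespace false
-- (single-conjunct summit: the namespace repeats `MatrixMultiplication`)

namespace Summit.MatrixMultiplication.MatrixMultiplication.Theorems.AutomaticPackingThesis

open Finset Literature.Combinatorics.Additive Literature.Computability.AlgebraicComplexity

/-- **Three-fold concatenation with product block sizes** (registered stub `stub_tripleConcat`
of line `Sketch`): three STPP designs in `ℤ/p^K₁`, `ℤ/p^K₂`, `ℤ/p^K₃` (indexed by `Fin n₁`,
`Fin n₂`, `Fin n₃`) concatenate into one STPP family in `ℤ/p^(K₁+K₂+K₃)` indexed by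
`Fin n₁ × Fin n₂ × Fin n₃` whose block sizes are the products of the corresponding block sizes
(`stub_concatSTPP` twice, `card_concat`, reindexing along `(i, j, k) ↦ ((i, j), k)`, i.e.
`(Equiv.prodAssoc _ _ _).symm`). [folklore] -/
theorem stub_tripleConcat (p K₁ K₂ K₃ n₁ n₂ n₃ : ℕ) (hp : 0 < p)
    (A₁ B₁ C₁ : Fin n₁ → Finset (ZMod (p ^ K₁))) (A₂ B₂ C₂ : Fin n₂ → Finset (ZMod (p ^ K₂)))
    (A₃ B₃ C₃ : Fin n₃ → Finset (ZMod (p ^ K₃)))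
    (h₁ : IsSTPP A₁ B₁ C₁) (h₂ : IsSTPP A₂ B₂ C₂) (h₃ : IsSTPP A₃ B₃ C₃) :
    ∃ (A B C : Fin n₁ × Fin n₂ × Fin n₃ → Finset (ZMod (p ^ (K₁ + K₂ + K₃)))),
      AddSimultaneousTPP A B C ∧
      ∀ i, (A i).card = (A₁ i.1).card * (A₂ i.2.1).card * (A₃ i.2.2).card ∧
        (B i).card = (B₁ i.1).card * (B₂ i.2.1).card * (B₃ i.2.2).card ∧
        (C i).card = (C₁ i.1).card * (C₂ i.2.1).card * (C₃ i.2.2).card := by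
  -- first concatenation: `K₁` (low digits) with `K₂` (high digits), indexed by `Fin n₁ × Fin n₂`
  have h₁₂ := stub_concatSTPP p K₁ K₂ hp (Fin n₁) (Fin n₂) A₁ B₁ C₁ A₂ B₂ C₂
    ((isSTPP_iff_addSimultaneousTPP A₁ B₁ C₁).1 h₁) ((isSTPP_iff_addSimultaneousTPP A₂ B₂ C₂).1 h₂)
  -- second concatenation: `K₁ + K₂` (low digits) with `K₃` (high digits),
  -- indexed by `(Fin n₁ × Fin n₂) × Fin n₃`
  have h₁₂₃ := stub_concatSTPP p (K₁ + K₂) K₃ hp (Fin n₁ × Fin n₂) (Fin n₃) _ _ _ A₃ B₃ C₃ h₁₂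
    ((isSTPP_iff_addSimultaneousTPP A₃ B₃ C₃).1 h₃)
  -- reindex along the injection `(i, j, k) ↦ ((i, j), k)`
  have he : Function.Injective fun i : Fin n₁ × Fin n₂ × Fin n₃ => ((i.1, i.2.1), i.2.2) := by
    rintro ⟨i, j, k⟩ ⟨i', j', k'⟩ h
    simp only [Prod.mk.injEq] at h
    obtain ⟨⟨rfl, rfl⟩, rfl⟩ := h
    rfl
  refine ⟨_, _, _, h₁₂₃.comp he, fun i => ?_⟩
  simp only [Function.comp_apply, card_concat p (K₁ + K₂) K₃ hp, card_concat p K₁ K₂ hp,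
    and_self]

end Summit.MatrixMultiplication.MatrixMultiplication.Theorems.AutomaticPackingThesis
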